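import Summits.QuantumFields.BalabanUV.Beta.CombWilsonT2Periodised

/-!
# `BalabanUV.Beta.CombWilsonT2PeriodisedK2` — binder row D1 (OWNER an2), (J-a) dictionary, item (α-3)-W, sequel: **PAIR SYMMETRY AND PARITY OF THE TORUS
# SECOND-ORDER WILSON MEMBER, THE SECOND-SLOT LAW, AND THE `k2` SIMILARITY WORD — the one-shot chart's `H′₂` IS the bi-stencil along `(h + Dλ) ⊗ (h + Dλ)`,
# PROVIDED THE SECOND-ORDER FORM WEIGHT IS THE SQUARE OF THE FIRST-ORDER ONE**

WHAT ([folklore] BY NAME over `CombWilsonT2Periodised`; `T₂ := wilsonW₂ d ((8N²)⁻¹ • wsym22 N)`, `2 ≤ N`; the bi-family hypothesis-bound with the SECOND bond first: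
`hW : W = fun κ′ u′ κ u x z a c => Σ'_n T₂ κ u κ′ (translate M u′ n) x z a c`; torus member `H₂^{b,b′} := perF M (dper M (W b′.2 ↑b′.1 b.2 ↑b.1))∘(ff)`):
* §1 `wilsonT2_swap`, `wilsonT2_transpose_entry` (an3 ∕ leaf-09's letters through `wilsonW₂_smul`); `tsum_tsum_comm_of_support` (finite-support Fubini); `dper_wilsonT2per_apply`
  (the member's kernel is the DOUBLE copy sum `Σ'_m Σ'_n T₂ (b + M∘m) (b′ + M∘n)`); **`dper_wilsonT2per_swap`** (PAIR SYMMETRY) and **`trF_dper_wilsonT2per`** (LEG SYMMETRY).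
* §2 **`torus_H2_member_transpose`** (`(H₂^{b,b′})ᵀ = H₂^{b,b′}` — the door's `hH₂t` termwise), **`torus_H2_pureGauge_snd_fun`** (a torus pure gauge in the SECOND bond:
  `Σ_{b′} (Dλ)_{b′} • H₂^{b,b′} = ½ • (H₁^{b} * E_λ − E_λ * H₁^{b})`), the bi-weighted forms `torus_H2_gauge_fst ∕ _snd` and **`torus_H2_transpose`**.
* §3 at the torus call's types (`F = fine Lc M′`, leaf-05's `hH₀` at `j = 0`): `sum_sum_add_mul_add_smul`, `k2_sim_word` (pure algebra) and
  **`torus_k2_sim_letter`**: with `X := (w∕2) • E_λ`, `H₁ := w • H₁^{(h)} + L` (`L` ANY additive first-order family — at the literal the Λ-sector jet;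
  `L = 0` the pure Wilson sector), `H₂ := w² • H₂^{(h,h)}`, the door's `k2` left side `(X X)ᵀ H₀ − XᵀH₁ − XᵀH₀X − XᵀH₁ − XᵀH₀X + H₂ + H₁X + H₁X + H₀XX`
  EQUALS `w² • H₂^{(h + Dλ, h + Dλ)} + w • (L E_λ − E_λ L)` — at leaf-02's pin `X = −c•E_λ` (`w = −2c`, leaf-05's `torus_k1_sim_letter`) the order-2 form
  weight must be `w² = 4c²`: in road currency the DIRECTION is rescaled by `b_j`, so the literal's order-2 member is read ÷ `b_j²` and `cE₂∕b₀² = (cE∕b₀)²`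
  iff `cE₂ = cE²` — the literal's `Lc⁸ = (Lc⁴)²` (`CombWilsonT2GaugeLetter` §2).  Nothing of the weights is asserted here beyond this displayed arithmetic;
  the `L`-commutator is DISPLAYED (located question Q-an2-g42-1 to the OWNER).
NOT HERE: `a2`, the border∕mixed order-2 rows, levels `j ≥ 1`; nothing of Bałaban's asserted; `D1Tel`∕`D1Rep` OPEN; NOT (T-ID), NOT D1, NOT BetaPertH, NOT continuum, NOT Clay.

HONEST DEPENDENCY (page 1, mandatory): continuum YM on T⁴ ⇐ BetaPertH ∧ nine spine estimates (0/9 proved); BetaPertH ⇐ (D1) ∧ (D4) ∧ CAP+tail;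
G-an2-4 gates asym, D1 and NE2/3/4.  HONEST FRAMING (cell contract, verbatim): «discharging `BetaPertH` makes Bałaban's UV stability UNCONDITIONAL —
a real constructive-QFT result; it is NOT the continuum limit and NOT the Clay problem.»  ABSOLUTE RULE (cell charter, verbatim): «No internally-minted
statement may enter as a cited fact. Every hypothesis is either kernel-proved in this package or a verbatim quotation of a PUBLISHED theorem with page
reference. The manuscript(s) under audit are NOT citable for their own disputed steps — they are the thing under adjudication; programme-internal
(2001/route/tribunal) claims are never citable.»  Row D1 OWNER an2 (b2b-balaban-beta-an2) gen 42, 2026-08-22.  No existing file touched.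
-/

noncomputable section

open scoped BigOperators

namespace Summit.QuantumFields.BalabanUV.Beta.CombWilsonT2PeriodisedK2

open Finset Matrix
open Literature.MathematicalPhysics.QuantumFieldTheory.Balaban1983to89
open Literature.MathematicalPhysics.QuantumFieldTheory.Balaban1983to89.Beta
open B12Sec2to5 (l1)
open B4TorusKernel.MultiPeriod (translate translate_apply)
open B5Prop11Plancherel (fine)
open B6Lemma24Torus (pbox mem_pbox)
open ExpKernelCalculus (MKer)
open StepJetData (wilsonA)
open WilsonBiStencil (wilsonW₂ wilsonW₂_inl_inl wEntry₂_eq_zero_or wilsonW₂_smul)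
open WilsonVertex2Sym (wsym22)
open AffineAveraging (Site toSite)
open OneStepResolventKernel (Fib)
open Summit.QuantumFields.BalabanUV.Beta.BorderedHessian (bhKStepAt)
open Summit.QuantumFields.BalabanUV.Beta.AxialDressingRooted (cube mem_cube)
open Summit.QuantumFields.BalabanUV.Beta.GAN24.Push3GaugeSlotCells (mem_cube_of_l1_le)
open Summit.QuantumFields.BalabanUV.Beta.WilsonBiStencilWardSocket (wilsonW₂_wsym22_swap wilsonW₂_wsym22_transpose)
open Summit.QuantumFields.BalabanUV.Beta.FP.KernelPeriodisationFib (Idx perF perF_apply perZ perZ_apply perF_transpose trF)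
open Summit.QuantumFields.BalabanUV.Beta.FP.KernelPeriodisationFibLoc (dper dper_apply dper_translate)
open Summit.QuantumFields.BalabanUV.Beta.FP.TorusGaugeCovariance (tdelta tgrad)
open Summit.QuantumFields.BalabanUV.Beta.FP.PeriodisedBorderIndexWard (translate_injective)
open Summit.QuantumFields.BalabanUV.Beta.FP.PeriodisedFormIndexWard (torus_H1_pureGauge_fun)
open Summit.QuantumFields.BalabanUV.Beta.CombWilsonT2Periodised (dper_apply_of_periodCov wilsonT2per_periodCov torus_H2_pureGauge_fst_fun)

variable {d : ℕ} {N : ℕ}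

/-! ## §1 Pair and leg symmetry of the copy sums -/

section Symmetry

variable (M : Fin (d + 1) → ℕ) [∀ μ, NeZero (M μ)]

omit [∀ μ, NeZero (M μ)] in
/-- [folklore] pair symmetry of the literal's table (`wilsonW₂_wsym22_swap` through `wilsonW₂_smul`). -/
theorem wilsonT2_swap (κ : Fin (d + 1)) (u : Site (d + 1)) (κ' : Fin (d + 1)) (u' : Site (d + 1)) :
    wilsonW₂ d ((8 * (N : ℝ) ^ 2)⁻¹ • wsym22 N) κ' u' κ u = wilsonW₂ d ((8 * (N : ℝ) ^ 2)⁻¹ • wsym22 N) κ u κ' u' := by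
  rw [wilsonW₂_smul, wilsonW₂_smul, wilsonW₂_wsym22_swap]

omit [∀ μ, NeZero (M μ)] in
/-- [folklore] leg symmetry of the literal's table, entrywise (`wilsonW₂_wsym22_transpose` through `wilsonW₂_smul`). -/
theorem wilsonT2_transpose_entry (κ : Fin (d + 1)) (u : Site (d + 1)) (κ' : Fin (d + 1)) (u' x z : Site (d + 1)) (a c : Fib d) :
    wilsonW₂ d ((8 * (N : ℝ) ^ 2)⁻¹ • wsym22 N) κ u κ' u' z x c a = wilsonW₂ d ((8 * (N : ℝ) ^ 2)⁻¹ • wsym22 N) κ u κ' u' x z a c := by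
  rw [wilsonW₂_smul]
  simp only [Pi.smul_apply, smul_eq_mul]
  rw [wilsonW₂_wsym22_transpose]

omit [∀ μ, NeZero (M μ)] in
/-- [folklore] **FINITE-SUPPORT FUBINI**: a real double family supported in a finite rectangle has commuting iterated `tsum`s. -/
theorem tsum_tsum_comm_of_support {ι ι' : Type*} (f : ι → ι' → ℝ) (s : Finset ι) (t : Finset ι')
    (hs : ∀ m ∉ s, ∀ n, f m n = 0) (ht : ∀ n ∉ t, ∀ m, f m n = 0) :
    ∑' m, ∑' n, f m n = ∑' n, ∑' m, f m n := by
  have h1 : ∀ m, ∑' n, f m n = ∑ n ∈ t, f m n := fun m => tsum_eq_sum fun n hn => ht n hn m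
  have h2 : ∀ n, ∑' m, f m n = ∑ m ∈ s, f m n := fun n => tsum_eq_sum fun m hm => hs m hm n
  simp only [h1, h2]
  rw [tsum_eq_sum (s := s) fun m hm => Finset.sum_eq_zero fun n _ => hs m hm n,
    tsum_eq_sum (s := t) fun n hn => Finset.sum_eq_zero fun m _ => ht n hn m, Finset.sum_comm]

variable {M}
variable {W : Fin (d + 1) → Site (d + 1) → Fin (d + 1) → Site (d + 1) → MKer (d + 1) (Fib d)}

omit [∀ μ, NeZero (M μ)] in
/-- [folklore] **THE MEMBER's KERNEL IS THE DOUBLE COPY SUM**: `dper M (W κ′ u′ κ u) x z a c = Σ'_m Σ'_n T₂ κ (u + M∘m) κ′ (u′ + M∘n) x z a c`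
(`dper_apply_of_periodCov` + `wilsonT2per_periodCov`). -/
theorem dper_wilsonT2per_apply
    (hW : W = fun κ' u' κ u x z a c => ∑' n : Site (d + 1), wilsonW₂ d ((8 * (N : ℝ) ^ 2)⁻¹ • wsym22 N) κ u κ' (translate M u' n) x z a c)
    (κ' : Fin (d + 1)) (u' : Site (d + 1)) (κ : Fin (d + 1)) (u x z : Site (d + 1)) (a c : Fib d) :
    dper M (W κ' u' κ u) x z a c = ∑' m : Site (d + 1), ∑' n : Site (d + 1),
      wilsonW₂ d ((8 * (N : ℝ) ^ 2)⁻¹ • wsym22 N) κ (translate M u m) κ' (translate M u' n) x z a c := by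
  have hV : W κ' u' = fun κ u x z a c => ∑' n : Site (d + 1), wilsonW₂ d ((8 * (N : ℝ) ^ 2)⁻¹ • wsym22 N) κ u κ' (translate M u' n) x z a c := by
    rw [hW]
  rw [dper_apply_of_periodCov (W κ' u') (wilsonT2per_periodCov _ hV) κ u x z a c, hV]

/-- [folklore] the double copy sum of the ff entries commutes (both copy indices range over finite windows: `|x − (u+M∘m)|₁ ≤ 2`, `|z − (u′+M∘n)|₁ ≤ 2`). -/
theorem tsum_tsum_wilsonT2_comm (T : Fin 4 → Fin 4 → Fin 4 → Fin 4 → ℝ) (κ : Fin (d + 1)) (u : Site (d + 1)) (κ' : Fin (d + 1))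
    (u' x z : Site (d + 1)) (α γ : Fin (d + 1)) :
    ∑' m : Site (d + 1), ∑' n : Site (d + 1), wilsonW₂ d T κ (translate M u m) κ' (translate M u' n) x z (Sum.inl α) (Sum.inl γ)
      = ∑' n : Site (d + 1), ∑' m : Site (d + 1), wilsonW₂ d T κ (translate M u m) κ' (translate M u' n) x z (Sum.inl α) (Sum.inl γ) := by
  refine tsum_tsum_comm_of_support
    (fun m n => wilsonW₂ d T κ (translate M u m) κ' (translate M u' n) x z (Sum.inl α) (Sum.inl γ))
    (((cube (d + 1) 2).image (fun v => x - v)).preimage (fun m => translate M u m) (translate_injective (M := M) u).injOn)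
    (((cube (d + 1) 2).image (fun v => z - v)).preimage (fun n => translate M u' n) (translate_injective (M := M) u').injOn)
    (fun m hm n => ?_) (fun n hn m => ?_)
  · show wilsonW₂ d T κ (translate M u m) κ' (translate M u' n) x z (Sum.inl α) (Sum.inl γ) = 0
    rw [wilsonW₂_inl_inl]
    rcases wEntry₂_eq_zero_or T κ (translate M u m) κ' (translate M u' n) x z α γ with h0 | ⟨hx, -, -⟩
    · exact h0
    · exact absurd (Finset.mem_preimage.2 (Finset.mem_image.2 ⟨x - translate M u m, mem_cube_of_l1_le hx, sub_sub_cancel _ _⟩)) hm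
  · show wilsonW₂ d T κ (translate M u m) κ' (translate M u' n) x z (Sum.inl α) (Sum.inl γ) = 0
    rw [wilsonW₂_inl_inl]
    rcases wEntry₂_eq_zero_or T κ (translate M u m) κ' (translate M u' n) x z α γ with h0 | ⟨-, hz, -⟩
    · exact h0
    · exact absurd (Finset.mem_preimage.2 (Finset.mem_image.2 ⟨z - translate M u' n, mem_cube_of_l1_le hz, sub_sub_cancel _ _⟩)) hn

/-- [folklore] **PAIR SYMMETRY OF THE TORUS MEMBER's KERNEL**: `dper M (W κ′ u′ κ u) = dper M (W κ u κ′ u′)` — swap the tables (`wilsonT2_swap`) and the two copy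
sums (finite-support Fubini on the ff block; the other blocks vanish). -/
theorem dper_wilsonT2per_swap
    (hW : W = fun κ' u' κ u x z a c => ∑' n : Site (d + 1), wilsonW₂ d ((8 * (N : ℝ) ^ 2)⁻¹ • wsym22 N) κ u κ' (translate M u' n) x z a c)
    (κ' : Fin (d + 1)) (u' : Site (d + 1)) (κ : Fin (d + 1)) (u : Site (d + 1)) :
    dper M (W κ' u' κ u) = dper M (W κ u κ' u') := by
  funext x z a c
  rw [dper_wilsonT2per_apply hW, dper_wilsonT2per_apply hW]
  rcases a with α | α <;> rcases c with γ | γ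
  · rw [tsum_tsum_wilsonT2_comm (M := M) _ κ u κ' u' x z α γ]
    exact tsum_congr fun n => tsum_congr fun m => by
      rw [← wilsonT2_swap (N := N) κ (translate M u m) κ' (translate M u' n)]
  · simp only [WilsonBiStencil.wilsonW₂_inl_inr, tsum_zero]
  · simp only [WilsonBiStencil.wilsonW₂_inr_inl, tsum_zero]
  · simp only [WilsonBiStencil.wilsonW₂_inr_inr, tsum_zero]

omit [∀ μ, NeZero (M μ)] in
/-- [folklore] **LEG SYMMETRY OF THE TORUS MEMBER's KERNEL**: `trF (dper M (W κ′ u′ κ u)) = dper M (W κ′ u′ κ u)` (termwise `wilsonT2_transpose_entry`; no convergence needed). -/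
theorem trF_dper_wilsonT2per
    (hW : W = fun κ' u' κ u x z a c => ∑' n : Site (d + 1), wilsonW₂ d ((8 * (N : ℝ) ^ 2)⁻¹ • wsym22 N) κ u κ' (translate M u' n) x z a c)
    (κ' : Fin (d + 1)) (u' : Site (d + 1)) (κ : Fin (d + 1)) (u : Site (d + 1)) :
    trF (dper M (W κ' u' κ u)) = dper M (W κ' u' κ u) := by
  funext x z a c
  simp only [trF, dper_apply]
  subst hW
  exact tsum_congr fun m => tsum_congr fun n => wilsonT2_transpose_entry (N := N) κ u κ' (translate M u' n) _ _ a c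

end Symmetry

/-! ## §2 The torus member: parity, the second-slot law, the bi-weighted forms -/

section Member

variable (M : Fin (d + 1) → ℕ) [∀ μ, NeZero (M μ)]
  {W : Fin (d + 1) → Site (d + 1) → Fin (d + 1) → Site (d + 1) → MKer (d + 1) (Fib d)}

omit [∀ μ, NeZero (M μ)] in
/-- [folklore] **`hH₂t` TERMWISE — EACH TORUS SECOND-ORDER WILSON MEMBER IS A SYMMETRIC MATRIX**: `(H₂^{b,b′})ᵀ = H₂^{b,b′}`,
`H₂^{b,b′} := perF M (dper M (W b′.2 ↑b′.1 b.2 ↑b.1))∘(ff)` (gan24-p3's `perF_transpose` on the `Mℤ`-invariant `dper`, + `trF_dper_wilsonT2per`).  Per copy this is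
leaf-05 g28's `PeriodisedFormOrderTwoParity.perF_dper_wilsonW₂_transpose` (INTENT 25; stated for arbitrary lattice pairs, so every copy `(κ′, u′ + M∘n)` is an
instance); here the copy sum sits INSIDE `dper`, so the leg symmetry is taken termwise under both sums instead of exchanging `perF ∘ dper` with the copy sum. -/
theorem torus_H2_member_transpose
    (hW : W = fun κ' u' κ u x z a c => ∑' n : Site (d + 1), wilsonW₂ d ((8 * (N : ℝ) ^ 2)⁻¹ • wsym22 N) κ u κ' (translate M u' n) x z a c)
    (b b' : ↥(pbox M) × Fin (d + 1)) :
    ((perF M (dper M (W b'.2 (b'.1 : Site (d + 1)) b.2 (b.1 : Site (d + 1))))).submatrix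
        (fun c : ↥(pbox M) × Fin (d + 1) => ((c.1, Sum.inl c.2) : Idx M (Fib d)))
        (fun c : ↥(pbox M) × Fin (d + 1) => ((c.1, Sum.inl c.2) : Idx M (Fib d))))ᵀ
      = (perF M (dper M (W b'.2 (b'.1 : Site (d + 1)) b.2 (b.1 : Site (d + 1))))).submatrix
        (fun c : ↥(pbox M) × Fin (d + 1) => ((c.1, Sum.inl c.2) : Idx M (Fib d)))
        (fun c : ↥(pbox M) × Fin (d + 1) => ((c.1, Sum.inl c.2) : Idx M (Fib d))) := by
  rw [Matrix.transpose_submatrix, ← perF_transpose M (fun m x y a c => dper_translate M _ m x y a c), trF_dper_wilsonT2per hW]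

/-- [folklore] **`torus_H2_pureGauge_snd_fun` — A TORUS PURE GAUGE IN THE SECOND BOND** (pair symmetry + the first-slot law of `CombWilsonT2Periodised`): for every torus
bond `b` and torus gauge function `λ`, `Σ_{b′} (Dλ)_{b′} • H₂^{b,b′} = ½ • (H₁^{b} * E_λ − E_λ * H₁^{b})`, `H₁^{b} := perF M (dper M (wilsonA d b.2 ↑b.1))∘(ff)`. -/
theorem torus_H2_pureGauge_snd_fun (hN : 2 ≤ N)
    (hW : W = fun κ' u' κ u x z a c => ∑' n : Site (d + 1), wilsonW₂ d ((8 * (N : ℝ) ^ 2)⁻¹ • wsym22 N) κ u κ' (translate M u' n) x z a c)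
    (b : ↥(pbox M) × Fin (d + 1)) (lam : ↥(pbox M) → ℝ) :
    (∑ b' : ↥(pbox M) × Fin (d + 1), (∑ s : ↥(pbox M), tgrad M (b'.1, Sum.inl b'.2) s * lam s) •
        (perF M (dper M (W b'.2 (b'.1 : Site (d + 1)) b.2 (b.1 : Site (d + 1))))).submatrix
          (fun c : ↥(pbox M) × Fin (d + 1) => ((c.1, Sum.inl c.2) : Idx M (Fib d)))
          (fun c : ↥(pbox M) × Fin (d + 1) => ((c.1, Sum.inl c.2) : Idx M (Fib d))))
      = (1 / 2 : ℝ) • ((perF M (dper M (wilsonA d b.2 (b.1 : Site (d + 1))))).submatrix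
            (fun c : ↥(pbox M) × Fin (d + 1) => ((c.1, Sum.inl c.2) : Idx M (Fib d)))
            (fun c : ↥(pbox M) × Fin (d + 1) => ((c.1, Sum.inl c.2) : Idx M (Fib d)))
          * Matrix.diagonal (fun c : ↥(pbox M) × Fin (d + 1) => lam c.1)
        - Matrix.diagonal (fun c : ↥(pbox M) × Fin (d + 1) => lam c.1)
          * (perF M (dper M (wilsonA d b.2 (b.1 : Site (d + 1))))).submatrix
            (fun c : ↥(pbox M) × Fin (d + 1) => ((c.1, Sum.inl c.2) : Idx M (Fib d)))
            (fun c : ↥(pbox M) × Fin (d + 1) => ((c.1, Sum.inl c.2) : Idx M (Fib d)))) := by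
  have hV : W b.2 (b.1 : Site (d + 1)) = fun κ u x z a c =>
      ∑' n : Site (d + 1), wilsonW₂ d ((8 * (N : ℝ) ^ 2)⁻¹ • wsym22 N) κ u b.2 (translate M (b.1 : Site (d + 1)) n) x z a c := by
    rw [hW]
  rw [Finset.sum_congr rfl fun b' _ => by rw [dper_wilsonT2per_swap hW b'.2 (b'.1 : Site (d + 1)) b.2 (b.1 : Site (d + 1))]]
  exact torus_H2_pureGauge_fst_fun M b.2 (b.1 : Site (d + 1)) hN hV lam

/-- [folklore] **BI-WEIGHTED, GAUGE IN THE FIRST SLOT**: `Σ_b Σ_{b′} ((Dλ)_b · g b′) • H₂^{b,b′} = ½ • (H₁^{(g)} * E_λ − E_λ * H₁^{(g)})`, `H₁^{(g)} := Σ_{b′} g b′ • H₁^{b′}`. -/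
theorem torus_H2_gauge_fst (hN : 2 ≤ N)
    (hW : W = fun κ' u' κ u x z a c => ∑' n : Site (d + 1), wilsonW₂ d ((8 * (N : ℝ) ^ 2)⁻¹ • wsym22 N) κ u κ' (translate M u' n) x z a c)
    (g : ↥(pbox M) × Fin (d + 1) → ℝ) (lam : ↥(pbox M) → ℝ) :
    (∑ b : ↥(pbox M) × Fin (d + 1), ∑ b' : ↥(pbox M) × Fin (d + 1),
        ((∑ s : ↥(pbox M), tgrad M (b.1, Sum.inl b.2) s * lam s) * g b') •
          (perF M (dper M (W b'.2 (b'.1 : Site (d + 1)) b.2 (b.1 : Site (d + 1))))).submatrix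
            (fun c : ↥(pbox M) × Fin (d + 1) => ((c.1, Sum.inl c.2) : Idx M (Fib d)))
            (fun c : ↥(pbox M) × Fin (d + 1) => ((c.1, Sum.inl c.2) : Idx M (Fib d))))
      = (1 / 2 : ℝ) • ((∑ b' : ↥(pbox M) × Fin (d + 1), g b' • (perF M (dper M (wilsonA d b'.2 (b'.1 : Site (d + 1))))).submatrix
            (fun c : ↥(pbox M) × Fin (d + 1) => ((c.1, Sum.inl c.2) : Idx M (Fib d)))
            (fun c : ↥(pbox M) × Fin (d + 1) => ((c.1, Sum.inl c.2) : Idx M (Fib d))))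
          * Matrix.diagonal (fun c : ↥(pbox M) × Fin (d + 1) => lam c.1)
        - Matrix.diagonal (fun c : ↥(pbox M) × Fin (d + 1) => lam c.1)
          * ∑ b' : ↥(pbox M) × Fin (d + 1), g b' • (perF M (dper M (wilsonA d b'.2 (b'.1 : Site (d + 1))))).submatrix
            (fun c : ↥(pbox M) × Fin (d + 1) => ((c.1, Sum.inl c.2) : Idx M (Fib d)))
            (fun c : ↥(pbox M) × Fin (d + 1) => ((c.1, Sum.inl c.2) : Idx M (Fib d)))) := by
  rw [Finset.sum_comm]
  have hinner : ∀ b' : ↥(pbox M) × Fin (d + 1), (∑ b : ↥(pbox M) × Fin (d + 1),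
        ((∑ s : ↥(pbox M), tgrad M (b.1, Sum.inl b.2) s * lam s) * g b') •
          (perF M (dper M (W b'.2 (b'.1 : Site (d + 1)) b.2 (b.1 : Site (d + 1))))).submatrix
            (fun c : ↥(pbox M) × Fin (d + 1) => ((c.1, Sum.inl c.2) : Idx M (Fib d)))
            (fun c : ↥(pbox M) × Fin (d + 1) => ((c.1, Sum.inl c.2) : Idx M (Fib d))))
      = g b' • ((1 / 2 : ℝ) • ((perF M (dper M (wilsonA d b'.2 (b'.1 : Site (d + 1))))).submatrix
            (fun c : ↥(pbox M) × Fin (d + 1) => ((c.1, Sum.inl c.2) : Idx M (Fib d)))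
            (fun c : ↥(pbox M) × Fin (d + 1) => ((c.1, Sum.inl c.2) : Idx M (Fib d)))
          * Matrix.diagonal (fun c : ↥(pbox M) × Fin (d + 1) => lam c.1)
        - Matrix.diagonal (fun c : ↥(pbox M) × Fin (d + 1) => lam c.1)
          * (perF M (dper M (wilsonA d b'.2 (b'.1 : Site (d + 1))))).submatrix
            (fun c : ↥(pbox M) × Fin (d + 1) => ((c.1, Sum.inl c.2) : Idx M (Fib d)))
            (fun c : ↥(pbox M) × Fin (d + 1) => ((c.1, Sum.inl c.2) : Idx M (Fib d))))) := fun b' => by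
    have hV : W b'.2 (b'.1 : Site (d + 1)) = fun κ u x z a c =>
        ∑' n : Site (d + 1), wilsonW₂ d ((8 * (N : ℝ) ^ 2)⁻¹ • wsym22 N) κ u b'.2 (translate M (b'.1 : Site (d + 1)) n) x z a c := by
      rw [hW]
    rw [← torus_H2_pureGauge_fst_fun M b'.2 (b'.1 : Site (d + 1)) hN hV lam, Finset.smul_sum]
    exact Finset.sum_congr rfl fun b _ => by rw [mul_comm, smul_smul]
  rw [Finset.sum_congr rfl fun b' _ => hinner b', Finset.sum_mul, Finset.mul_sum, ← Finset.sum_sub_distrib, Finset.smul_sum]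
  refine Finset.sum_congr rfl fun b' _ => ?_
  rw [Matrix.smul_mul, Matrix.mul_smul, ← smul_sub, smul_comm]

/-- [folklore] **BI-WEIGHTED, GAUGE IN THE SECOND SLOT**: `Σ_b Σ_{b′} (g b · (Dλ)_{b′}) • H₂^{b,b′} = ½ • (H₁^{(g)} * E_λ − E_λ * H₁^{(g)})`. -/
theorem torus_H2_gauge_snd (hN : 2 ≤ N)
    (hW : W = fun κ' u' κ u x z a c => ∑' n : Site (d + 1), wilsonW₂ d ((8 * (N : ℝ) ^ 2)⁻¹ • wsym22 N) κ u κ' (translate M u' n) x z a c)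
    (g : ↥(pbox M) × Fin (d + 1) → ℝ) (lam : ↥(pbox M) → ℝ) :
    (∑ b : ↥(pbox M) × Fin (d + 1), ∑ b' : ↥(pbox M) × Fin (d + 1),
        (g b * ∑ s : ↥(pbox M), tgrad M (b'.1, Sum.inl b'.2) s * lam s) •
          (perF M (dper M (W b'.2 (b'.1 : Site (d + 1)) b.2 (b.1 : Site (d + 1))))).submatrix
            (fun c : ↥(pbox M) × Fin (d + 1) => ((c.1, Sum.inl c.2) : Idx M (Fib d)))
            (fun c : ↥(pbox M) × Fin (d + 1) => ((c.1, Sum.inl c.2) : Idx M (Fib d))))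
      = (1 / 2 : ℝ) • ((∑ b : ↥(pbox M) × Fin (d + 1), g b • (perF M (dper M (wilsonA d b.2 (b.1 : Site (d + 1))))).submatrix
            (fun c : ↥(pbox M) × Fin (d + 1) => ((c.1, Sum.inl c.2) : Idx M (Fib d)))
            (fun c : ↥(pbox M) × Fin (d + 1) => ((c.1, Sum.inl c.2) : Idx M (Fib d))))
          * Matrix.diagonal (fun c : ↥(pbox M) × Fin (d + 1) => lam c.1)
        - Matrix.diagonal (fun c : ↥(pbox M) × Fin (d + 1) => lam c.1)
          * ∑ b : ↥(pbox M) × Fin (d + 1), g b • (perF M (dper M (wilsonA d b.2 (b.1 : Site (d + 1))))).submatrix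
            (fun c : ↥(pbox M) × Fin (d + 1) => ((c.1, Sum.inl c.2) : Idx M (Fib d)))
            (fun c : ↥(pbox M) × Fin (d + 1) => ((c.1, Sum.inl c.2) : Idx M (Fib d)))) := by
  have hinner : ∀ b : ↥(pbox M) × Fin (d + 1), (∑ b' : ↥(pbox M) × Fin (d + 1),
        (g b * ∑ s : ↥(pbox M), tgrad M (b'.1, Sum.inl b'.2) s * lam s) •
          (perF M (dper M (W b'.2 (b'.1 : Site (d + 1)) b.2 (b.1 : Site (d + 1))))).submatrix
            (fun c : ↥(pbox M) × Fin (d + 1) => ((c.1, Sum.inl c.2) : Idx M (Fib d)))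
            (fun c : ↥(pbox M) × Fin (d + 1) => ((c.1, Sum.inl c.2) : Idx M (Fib d))))
      = g b • ((1 / 2 : ℝ) • ((perF M (dper M (wilsonA d b.2 (b.1 : Site (d + 1))))).submatrix
            (fun c : ↥(pbox M) × Fin (d + 1) => ((c.1, Sum.inl c.2) : Idx M (Fib d)))
            (fun c : ↥(pbox M) × Fin (d + 1) => ((c.1, Sum.inl c.2) : Idx M (Fib d)))
          * Matrix.diagonal (fun c : ↥(pbox M) × Fin (d + 1) => lam c.1)
        - Matrix.diagonal (fun c : ↥(pbox M) × Fin (d + 1) => lam c.1)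
          * (perF M (dper M (wilsonA d b.2 (b.1 : Site (d + 1))))).submatrix
            (fun c : ↥(pbox M) × Fin (d + 1) => ((c.1, Sum.inl c.2) : Idx M (Fib d)))
            (fun c : ↥(pbox M) × Fin (d + 1) => ((c.1, Sum.inl c.2) : Idx M (Fib d))))) := fun b => by
    rw [← torus_H2_pureGauge_snd_fun M hN hW b lam, Finset.smul_sum]
    exact Finset.sum_congr rfl fun b' _ => by rw [smul_smul]
  rw [Finset.sum_congr rfl fun b _ => hinner b, Finset.sum_mul, Finset.mul_sum, ← Finset.sum_sub_distrib, Finset.smul_sum]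
  refine Finset.sum_congr rfl fun b _ => ?_
  rw [Matrix.smul_mul, Matrix.mul_smul, ← smul_sub, smul_comm]

omit [∀ μ, NeZero (M μ)] in
/-- [folklore] **`hH₂t` FOR THE BI-WEIGHTED JET**: `(Σ_b Σ_{b′} (g b · g′ b′) • H₂^{b,b′})ᵀ = Σ_b Σ_{b′} (g b · g′ b′) • H₂^{b,b′}` (termwise `torus_H2_member_transpose`). -/
theorem torus_H2_transpose
    (hW : W = fun κ' u' κ u x z a c => ∑' n : Site (d + 1), wilsonW₂ d ((8 * (N : ℝ) ^ 2)⁻¹ • wsym22 N) κ u κ' (translate M u' n) x z a c)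
    (g g' : ↥(pbox M) × Fin (d + 1) → ℝ) :
    (∑ b : ↥(pbox M) × Fin (d + 1), ∑ b' : ↥(pbox M) × Fin (d + 1), (g b * g' b') •
        (perF M (dper M (W b'.2 (b'.1 : Site (d + 1)) b.2 (b.1 : Site (d + 1))))).submatrix
          (fun c : ↥(pbox M) × Fin (d + 1) => ((c.1, Sum.inl c.2) : Idx M (Fib d)))
          (fun c : ↥(pbox M) × Fin (d + 1) => ((c.1, Sum.inl c.2) : Idx M (Fib d))))ᵀ
      = ∑ b : ↥(pbox M) × Fin (d + 1), ∑ b' : ↥(pbox M) × Fin (d + 1), (g b * g' b') •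
        (perF M (dper M (W b'.2 (b'.1 : Site (d + 1)) b.2 (b.1 : Site (d + 1))))).submatrix
          (fun c : ↥(pbox M) × Fin (d + 1) => ((c.1, Sum.inl c.2) : Idx M (Fib d)))
          (fun c : ↥(pbox M) × Fin (d + 1) => ((c.1, Sum.inl c.2) : Idx M (Fib d))) := by
  rw [Matrix.transpose_sum]
  refine Finset.sum_congr rfl fun b _ => ?_
  rw [Matrix.transpose_sum]
  refine Finset.sum_congr rfl fun b' _ => ?_
  rw [Matrix.transpose_smul, torus_H2_member_transpose M hW b b']

end Member

/-! ## §3 The `k2` similarity word at the torus call's types: the one-shot chart's `H′₂` is the bi-stencil along `(h + Dλ) ⊗ (h + Dλ)`, weight `w²` -/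

section K2

/-- [folklore] bilinear expansion of a bi-weighted sum along a shifted weight. -/
theorem sum_sum_add_mul_add_smul {ι V : Type*} [Fintype ι] [AddCommGroup V] [Module ℝ V] (h D : ι → ℝ) (Φ : ι → ι → V) :
    ∑ b, ∑ b', ((h b + D b) * (h b' + D b')) • Φ b b'
      = ∑ b, ∑ b', (h b * h b') • Φ b b' + ∑ b, ∑ b', (D b * h b') • Φ b b' + ∑ b, ∑ b', (h b * D b') • Φ b b'
        + ∑ b, ∑ b', (D b * D b') • Φ b b' := by
  simp only [add_mul, mul_add, add_smul, Finset.sum_add_distrib]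
  abel

/-- [folklore] **PURE ALGEBRA OF THE `k2` WORD**: for symmetric `E` and `X := (w∕2) • E`, with `H₁ := w • B + L` (`L` any ADDITIVE first-order family — at
the literal the Λ-sector jet; `L = 0` = the pure Wilson sector), `H₂ := w² • A`:
`(X X)ᵀ C − XᵀH₁ − XᵀCX − XᵀH₁ − XᵀCX + H₂ + H₁X + H₁X + CXX = w² • (A + (B E − E B) + ¼ • (C E E − 2 • (E C E) + E E C)) + w • (L E − E L)` —
the door's `k2` left side against the bilinear expansion of the shifted direction, plus the commutator of the extra family with the generator. -/
theorem k2_sim_word {ν : Type*} [Fintype ν] [DecidableEq ν] (A B C E L : Matrix ν ν ℝ) (hE : Eᵀ = E) (w : ℝ)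
    {X : Matrix ν ν ℝ} (hX : X = (w / 2) • E) :
    (X * X)ᵀ * C + (-(Xᵀ * (w • B + L)) + -(Xᵀ * C * X))
        + ((-(Xᵀ * (w • B + L)) + -(Xᵀ * C * X)) + (w ^ 2 • A + (w • B + L) * X + ((w • B + L) * X + C * (X * X))))
      = w ^ 2 • (A + (B * E - E * B) + (1 / 4 : ℝ) • (C * E * E - (2 : ℝ) • (E * C * E) + E * E * C)) + w • (L * E - E * L) := by
  subst hX
  have hXt : ((w / 2) • E)ᵀ = (w / 2) • E := by rw [Matrix.transpose_smul, hE]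
  rw [Matrix.transpose_mul, hXt]
  simp only [Matrix.smul_mul, Matrix.mul_smul, smul_smul, smul_add, smul_sub, Matrix.mul_add, Matrix.add_mul, Matrix.mul_assoc]
  module

variable (M' : Fin (d + 1) → ℕ) [∀ μ, NeZero (M' μ)] {Lc : ℕ} [NeZero Lc] {r : Fin (d + 1) → ℕ}
  {W : Fin (d + 1) → Site (d + 1) → Fin (d + 1) → Site (d + 1) → MKer (d + 1) (Fib d)}

/-- [folklore] **`torus_k2_sim_letter` — THE SECOND-ORDER SIMILARITY WORD OF THE (STEP) DOOR FOR THE WILSON FORM SECTOR AT LEVEL 0** (`F = fine Lc M′`, leaf-05's `hH₀` at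
`j = 0`, `2 ≤ N`): with the DIAGONAL generator `X := (w∕2) • E_λ` (leaf-02's pin `X = −c•E_λ` ⟺ `w = −2c`, as for `torus_k1_sim_letter`), `H₁ := w • H₁^{(h)} + L` (leaf-05's
periodised Wilson family PLUS any additive first-order family `L` — at the literal the Λ-sector jet; `L = 0` the pure Wilson sector) and `H₂ := w² • H₂^{(h,h)}` (the torus
bi-member, weight THE SQUARE), for EVERY direction `h` and torus gauge function `λ`, the door's `k2` left side
`(X X)ᵀ H₀ − XᵀH₁ − XᵀH₀X − XᵀH₁ − XᵀH₀X + H₂ + H₁X + H₁X + H₀XX` EQUALS `w² • H₂^{(h + Dλ, h + Dλ)} + w • (L E_λ − E_λ L)` — the bi-stencil along the gauge-shifted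
direction, plus the commutator of the extra family with the generator (the index-gauge variation an order-2 companion of `L` would have to carry; the literal's
`T2RecOf … 0` is the PARTIAL `∂²_U` table and carries none — a located question for the OWNER's (TN) rule, not decided here).  Order-2 road currency: member ÷ `b_j²`
(direction × `b_j`); `cE₂∕b₀² = (cE∕b₀)²` iff `cE₂ = cE²` (`Lc⁸ = (Lc⁴)²` at the literal). -/
theorem torus_k2_sim_letter (hN : 2 ≤ N)
    (hW : W = fun κ' u' κ u x z a c =>
      ∑' n : Site (d + 1), wilsonW₂ d ((8 * (N : ℝ) ^ 2)⁻¹ • wsym22 N) κ u κ' (translate (fine Lc M') u' n) x z a c)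
    (w : ℝ) (h : ↥(pbox (fine Lc M')) × Fin (d + 1) → ℝ) (lam : ↥(pbox (fine Lc M')) → ℝ)
    {H₀ : Matrix (↥(pbox (fine Lc M')) × Fin (d + 1)) (↥(pbox (fine Lc M')) × Fin (d + 1)) ℝ}
    (hH₀ : H₀ = (perF (fine Lc M') (bhKStepAt d (toSite r) Lc 0)).submatrix
        (fun b : ↥(pbox (fine Lc M')) × Fin (d + 1) => ((b.1, Sum.inl b.2) : Idx (fine Lc M') (Fib d)))
        (fun b : ↥(pbox (fine Lc M')) × Fin (d + 1) => ((b.1, Sum.inl b.2) : Idx (fine Lc M') (Fib d))))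
    (L : Matrix (↥(pbox (fine Lc M')) × Fin (d + 1)) (↥(pbox (fine Lc M')) × Fin (d + 1)) ℝ)
    {X : Matrix (↥(pbox (fine Lc M')) × Fin (d + 1)) (↥(pbox (fine Lc M')) × Fin (d + 1)) ℝ}
    (hX : X = (w / 2) • Matrix.diagonal (fun b : ↥(pbox (fine Lc M')) × Fin (d + 1) => lam b.1)) :
    (X * X)ᵀ * H₀
        + (-(Xᵀ * (w • (∑ b : ↥(pbox (fine Lc M')) × Fin (d + 1), h b •
            (perF (fine Lc M') (dper (fine Lc M') (wilsonA d b.2 (b.1 : Site (d + 1))))).submatrix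
              (fun c : ↥(pbox (fine Lc M')) × Fin (d + 1) => ((c.1, Sum.inl c.2) : Idx (fine Lc M') (Fib d)))
              (fun c : ↥(pbox (fine Lc M')) × Fin (d + 1) => ((c.1, Sum.inl c.2) : Idx (fine Lc M') (Fib d)))) + L))
          + -(Xᵀ * H₀ * X))
        + ((-(Xᵀ * (w • (∑ b : ↥(pbox (fine Lc M')) × Fin (d + 1), h b •
            (perF (fine Lc M') (dper (fine Lc M') (wilsonA d b.2 (b.1 : Site (d + 1))))).submatrix
              (fun c : ↥(pbox (fine Lc M')) × Fin (d + 1) => ((c.1, Sum.inl c.2) : Idx (fine Lc M') (Fib d)))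
              (fun c : ↥(pbox (fine Lc M')) × Fin (d + 1) => ((c.1, Sum.inl c.2) : Idx (fine Lc M') (Fib d)))) + L))
          + -(Xᵀ * H₀ * X))
          + (w ^ 2 • (∑ b : ↥(pbox (fine Lc M')) × Fin (d + 1), ∑ b' : ↥(pbox (fine Lc M')) × Fin (d + 1), (h b * h b') •
              (perF (fine Lc M') (dper (fine Lc M') (W b'.2 (b'.1 : Site (d + 1)) b.2 (b.1 : Site (d + 1))))).submatrix
                (fun c : ↥(pbox (fine Lc M')) × Fin (d + 1) => ((c.1, Sum.inl c.2) : Idx (fine Lc M') (Fib d)))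
                (fun c : ↥(pbox (fine Lc M')) × Fin (d + 1) => ((c.1, Sum.inl c.2) : Idx (fine Lc M') (Fib d))))
            + (w • (∑ b : ↥(pbox (fine Lc M')) × Fin (d + 1), h b •
              (perF (fine Lc M') (dper (fine Lc M') (wilsonA d b.2 (b.1 : Site (d + 1))))).submatrix
                (fun c : ↥(pbox (fine Lc M')) × Fin (d + 1) => ((c.1, Sum.inl c.2) : Idx (fine Lc M') (Fib d)))
                (fun c : ↥(pbox (fine Lc M')) × Fin (d + 1) => ((c.1, Sum.inl c.2) : Idx (fine Lc M') (Fib d)))) + L) * X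
            + ((w • (∑ b : ↥(pbox (fine Lc M')) × Fin (d + 1), h b •
              (perF (fine Lc M') (dper (fine Lc M') (wilsonA d b.2 (b.1 : Site (d + 1))))).submatrix
                (fun c : ↥(pbox (fine Lc M')) × Fin (d + 1) => ((c.1, Sum.inl c.2) : Idx (fine Lc M') (Fib d)))
                (fun c : ↥(pbox (fine Lc M')) × Fin (d + 1) => ((c.1, Sum.inl c.2) : Idx (fine Lc M') (Fib d)))) + L) * X
              + H₀ * (X * X))))
      = w ^ 2 • (∑ b : ↥(pbox (fine Lc M')) × Fin (d + 1), ∑ b' : ↥(pbox (fine Lc M')) × Fin (d + 1),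
          ((h b + ∑ s : ↥(pbox (fine Lc M')), tgrad (fine Lc M') (b.1, Sum.inl b.2) s * lam s)
            * (h b' + ∑ s : ↥(pbox (fine Lc M')), tgrad (fine Lc M') (b'.1, Sum.inl b'.2) s * lam s)) •
          (perF (fine Lc M') (dper (fine Lc M') (W b'.2 (b'.1 : Site (d + 1)) b.2 (b.1 : Site (d + 1))))).submatrix
            (fun c : ↥(pbox (fine Lc M')) × Fin (d + 1) => ((c.1, Sum.inl c.2) : Idx (fine Lc M') (Fib d)))
            (fun c : ↥(pbox (fine Lc M')) × Fin (d + 1) => ((c.1, Sum.inl c.2) : Idx (fine Lc M') (Fib d))))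
        + w • (L * Matrix.diagonal (fun b : ↥(pbox (fine Lc M')) × Fin (d + 1) => lam b.1)
          - Matrix.diagonal (fun b : ↥(pbox (fine Lc M')) × Fin (d + 1) => lam b.1) * L) := by
  -- the three torus laws (first slot, second slot — this file; the first-order law — leaf-05) and the bilinear expansion of the shifted direction
  have law1 := fun g : ↥(pbox (fine Lc M')) × Fin (d + 1) → ℝ => torus_H2_gauge_fst (fine Lc M') hN hW g lam
  have law2 := fun g : ↥(pbox (fine Lc M')) × Fin (d + 1) → ℝ => torus_H2_gauge_snd (fine Lc M') hN hW g lam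
  have law0 := torus_H1_pureGauge_fun M' (r := r) lam hH₀
  rw [sum_sum_add_mul_add_smul, law1 h, law2 h, law1, law0,
    k2_sim_word _ (∑ b : ↥(pbox (fine Lc M')) × Fin (d + 1), h b •
      (perF (fine Lc M') (dper (fine Lc M') (wilsonA d b.2 (b.1 : Site (d + 1))))).submatrix
        (fun c : ↥(pbox (fine Lc M')) × Fin (d + 1) => ((c.1, Sum.inl c.2) : Idx (fine Lc M') (Fib d)))
        (fun c : ↥(pbox (fine Lc M')) × Fin (d + 1) => ((c.1, Sum.inl c.2) : Idx (fine Lc M') (Fib d)))) H₀ _ L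
      (Matrix.diagonal_transpose _) w hX]
  simp only [smul_add, smul_sub, smul_smul, Matrix.smul_mul, Matrix.mul_smul, Matrix.sub_mul, Matrix.mul_sub, Matrix.mul_assoc]
  module

end K2

end Summit.QuantumFields.BalabanUV.Beta.CombWilsonT2PeriodisedK2
end
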